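import Summits.Parity.GeneralizedHardyLittlewood.Theses.ParityWeightedChenSwitching

/-!
# Line `birth` — BC3 skeleton for the crux `MoebiusSwitchedHostLevel` (stmt-Parity-18664)

Route `ParityWeightedChenSwitching` (route-Parity-ParityWeightedChenSwitching, sub-problem
`GeneralizedHardyLittlewood`), crux decl
`Summit.Parity.GeneralizedHardyLittlewood.Theses.ParityWeightedChenSwitching.MoebiusSwitchedHostLevel`
(rank 3, binder `h₂` of the deciding theorem `closes`), K2 of the route header:

  `Σ_{1 ≤ m ≤ x^0.499} |Σ_{e ∈ chenSetB x, m ∣ e} μ(e)| = o(x / log² x)`  (`x : ℕ → ∞`),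

Möbius along Chen's switched host `B(x) = {p₁p₂p₃ − 2 : x^{1/8} ≤ p₁ < (x+3)^{1/3} ≤ p₂ ≤ p₃, p₁p₂p₃ ≤ x+2}`
(`Literature.NumberTheory.Sieve.Chen.chenSetB`, tree) has level of distribution `0.499` in main-term-free
`ℓ¹` form.  Scale: `#B(x) ≍ x / log x`, so the trivial bound for the left side is `≍ x` (by `Σ_m 1/φ(m)`),
and the crux asks for a saving of `(log x)^{3+ε}` spread over the moduli `m ≤ x^0.499`.

## The line: the route's own TWO-LAYER PLAN for K2 — split the moduli at `m = x^η`

The route header (TWO-LAYER PLAN) records `K2 ⇐ K2small → K2large → K2`: a range split of the outer sum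
at `m ≤ x^η`, pairing each range with the technique that owns it.  Writing `e = mk` (only squarefree `e`
count, and `μ(mk) = μ(m)μ(k)·1[(m,k)=1]`), the inner sum at modulus `m` is `± Σ_{k : mk ∈ B(x), (k,m)=1} μ(k)`,
Möbius along the `k ≤ (x+2)/m` with `mk + 2 = p₁p₂p₃` Chen-structured:

* `stub_smallModuli` — SOME positive level: `∃ η ∈ (0, 0.499)` with
  `Σ_{1 ≤ m ≤ x^η} |Σ_{e ∈ B(x), m ∣ e} μ(e)| = o(x / log² x)`.  Here `k` is LONG (`≥ x^{1−η}`) and each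
  inner sum is a one-variable correlation "μ(n) against the P₃-structure of n+2" along a progression —
  the ternary analogue of Möbius ⟂ shifted primes (its `m = 1` term alone is open: Lichtman 2020 proves the
  binary analogue only on average over shifts; Lichtman–Teräväinen 2022 the Hardy–Littlewood–Chowla hybrids
  on average).  Owner technology: pretentious / Matomäki–Radziwiłł–Tao–Teräväinen, entropy decrement, with the
  host opened as the Type-II object `p₁ · (p₂p₃)` (Cauchy–Schwarz over `p₂p₃` turns the `m = 1` term into
  two-point correlations `Σ_ℓ μ(p₁ℓ − 2) μ(p₁'ℓ − 2)` along dilated pairs, averaged over `(p₁, p₁')`).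
  The statement is monotone in `η` (non-negative summands over an initial segment), so any `η > 0` is as
  good as a smaller one; the cap `η < 0.499` only records that this is a PROPER initial segment of the crux.
* `stub_largeModuli` — EVERY positive level from below: `∀ η > 0`,
  `Σ_{x^η < m ≤ x^0.499} |Σ_{e ∈ B(x), m ∣ e} μ(e)| = o(x / log² x)`.  Here both `m ∈ (x^η, x^0.499]` and
  `k ≥ x^0.501` have size `≥ x^η`, the sum is genuinely bilinear (`Σ_m c_m Σ_k μ(k) 1_B(mk)` with signs
  `c_m`), and the owner technology is the dispersion method / large sieve with the μ-twist
  (Linnik–BFI–Fouvry; Motohashi's induction principle for Bombieri–Vinogradov means of convolutions), the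
  untwisted level-`(1/2 − δ)` distribution of `B` being PROVED in-tree
  (`Literature.NumberTheory.Sieve.Chen.chenRemainderExt_bound`).  The range never contains `m = 1`
  (`⌊x^η⌋₊ ≥ 1` for `x ≥ 1`), so this stub is NOT the crux at any `η`.
* `MoebiusSwitchedHostLevel_of : MoebiusSwitchedHostLevel` — the kernel-checked composition: take `η` from
  `stub_smallModuli`, feed it to `stub_largeModuli`, and bound the crux's outer sum over `Icc 1 ⌊x^0.499⌋₊`
  by the sum over the (disjoint) union `Icc 1 ⌊x^η⌋₊ ∪ Ioc ⌊x^η⌋₊ ⌊x^0.499⌋₊` of non-negative terms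
  (`split_le`), so that `crux =O (small + large) = o(x / log² x)`.  No comparison `x^η ≤ x^0.499` is needed.
  Its hypothetical form `(stub₁-sig) → (stub₂-sig) → MoebiusSwitchedHostLevel` is the `example` after it
  (an `example`, so that `MoebiusSwitchedHostLevel_of` stays the unique declaration concluding the crux).

Why both stubs are genuine (BC3): neither range alone gives the crux (`small` misses `(x^η, x^0.499]`,
`large` misses `[1, x^η]` incl. `m = 1`), neither mentions twin primes or `GeneralizedHardyLittlewood`, and
each is the K2-instance of a distinct open problem with its own literature (probes `bc/*_probe*.lean`:
`stub → crux` and `stub → GeneralizedHardyLittlewood` by `first | exact? | simpa | aesop` all FAIL).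
Negatives index (`ledger negatives --problem Parity`, 2026-08-17: stmt-Parity-9541, 14832, 4218): no stub is an
instance — none concerns `chenSetB`/Möbius level statements.  Disproof used: none exists
(`ledger crux ls stmt-Parity-18664`: no workfiles, no `Negative/` lemma).  `sorry` occurs ONLY in the two
`stub_*` theorems.
-/

namespace Summit.Parity.GeneralizedHardyLittlewood.Cruxes.MoebiusSwitchedHostLevel.Birth

-- the route file's own `open` context (so that the verbatim copies below elaborate to the crux's terms)
open scoped BigOperators Topology Classical
open Filter Asymptotics
open Literature.NumberTheory.Sieve.Chen (chenSetB)
open Summit.Parity.GeneralizedHardyLittlewood.Theses.ParityWeightedChenSwitching (MoebiusSwitchedHostLevel)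

/-! ### The two registered stubs -/

/-- **Stub 1 — K2 at SOME positive level (small moduli).**  There is `η ∈ (0, 0.499)` with
`Σ_{1 ≤ m ≤ x^η} |Σ_{e ∈ chenSetB x, m ∣ e} μ(e)| = o(x / log² x)`.
LOAD-BEARING, OPEN: contains the `m = 1` term `Σ_{e ∈ B(x)} μ(e) = o(x / log² x)` (log-power cancellation of
Möbius along the ternary shifted products `p₁p₂p₃ − 2`), the ternary analogue of "μ ⟂ shifted primes".
Why plausibly true: Chowla/Hardy–Littlewood heuristics (the factorisation of `e` is independent of that of
`e + 2`); the host is a Type-II object `p₁·(p₂p₃)` with `p₁ ∈ [x^{1/8}, x^{1/3})`, so after Cauchy–Schwarz the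
`m = 1` term is an AVERAGE over dilation pairs `(p₁, p₁')` of two-point Möbius correlations along
`(p₁ℓ − 2, p₁'ℓ − 2)` — the regime where Matomäki–Radziwiłł–Tao–Teräväinen technology has bitten before.
Why it might fail: pretentious methods lose `(log x)^c` and give no uniformity in `m`; a Siegel-zero
character mimicking `μ` biases `μ` along `e ≡ 0 (m)`.  Size: open-problem.
Leans on: `Literature.NumberTheory.Sieve.Chen.chenSetB`, `mem_chenSetB` (tree); Mathlib
`ArithmeticFunction.moebius`, `Asymptotics.IsLittleO`.  Sources: Lichtman2020 (arXiv:2009.08969),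
LichtmanTeravainen2022 (arXiv:2111.08912), MatomakiRadziwillTao2015, Harman2007 §14.2 p. 286. -/
theorem stub_smallModuli :
    ∃ η : ℝ, 0 < η ∧ η < 0.499 ∧
      (fun x : ℕ => ∑ m ∈ Finset.Icc 1 ⌊(x : ℝ) ^ η⌋₊,
          |∑ e ∈ (chenSetB x).filter (fun e => m ∣ e), (ArithmeticFunction.moebius e : ℝ)|) =o[atTop]
        fun x : ℕ => (x : ℝ) / Real.log x ^ 2 := by
  sorry

/-- **Stub 2 — K2 on every range of large moduli.**  For every `η > 0`:
`Σ_{x^η < m ≤ x^0.499} |Σ_{e ∈ chenSetB x, m ∣ e} μ(e)| = o(x / log² x)`.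
LOAD-BEARING, OPEN: μ-twisted, main-term-free level of distribution of the switched host on the moduli
`(x^η, x^0.499]` — both variables of `e = mk` have size `≥ x^η`, so this is the bilinear / dispersion regime
(Linnik, Bombieri–Friedlander–Iwaniec, Fouvry; Motohashi's induction principle), the untwisted analogue
being PROVED in-tree (`chenRemainderExt_bound`, level `1/2 − δ` for `B`).  Never contains `m = 1`.
Why plausibly true: inside the Bombieri–Vinogradov range `0.499 < 1/2`, fixed residue `e ≡ 0 (m)`, and the
large sieve controls `ℓ¹`-means over `m > x^η` of sequences with a Siegel–Walfisz property.
Why it might fail: the coefficient sequence `n ↦ μ(n)·1_B(n)` is a PRODUCT of a multiplicative function and a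
shifted convolution, not a convolution — Vaughan/Heath-Brown identities do not factor it, and the dispersion
sums `Σ_m 1_B(mk) 1_B(mk')` are prime-triple correlations along pairs of linear forms (only sieve upper bounds,
no asymptotics); uniformity as `η → 0` is a further demand.  Size: open-problem (L if a bilinear structure
theorem for `μ·1_B` in progressions is found).
Leans on: `Literature.NumberTheory.Sieve.Chen.chenSetB`, `chenRemainderExt_bound` (tree, proved);
Mathlib large-sieve vocabulary.  Sources: BombieriFriedlanderIwaniecActa1986, Motohashi1976, Fouvry1984,
Nathanson1996 Thms 10.7–10.8, ChenSciSinica1973. -/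
theorem stub_largeModuli :
    ∀ η : ℝ, 0 < η →
      (fun x : ℕ => ∑ m ∈ Finset.Ioc ⌊(x : ℝ) ^ η⌋₊ ⌊(x : ℝ) ^ (0.499 : ℝ)⌋₊,
          |∑ e ∈ (chenSetB x).filter (fun e => m ∣ e), (ArithmeticFunction.moebius e : ℝ)|) =o[atTop]
        fun x : ℕ => (x : ℝ) / Real.log x ^ 2 := by
  sorry

/-! ### Composition (kernel-checked; `sorry` enters only through the two `stub_*`) -/

/-- The pointwise split: for every `x` and every cut `K`, the crux's outer sum over `Icc 1 N` is at most the
sum over `Icc 1 K` plus the sum over `Ioc K N` (non-negative summands; `Icc 1 N ⊆ Icc 1 K ∪ Ioc K N`, a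
disjoint union — no comparison of `K` with `N` is needed). [folklore] -/
theorem split_le (a : ℕ → ℝ) (ha : ∀ m, 0 ≤ a m) (K N : ℕ) :
    ∑ m ∈ Finset.Icc 1 N, a m ≤ ∑ m ∈ Finset.Icc 1 K, a m + ∑ m ∈ Finset.Ioc K N, a m := by
  have hdisj : Disjoint (Finset.Icc 1 K) (Finset.Ioc K N) := by
    refine Finset.disjoint_left.mpr ?_
    intro m hm1 hm2
    simp only [Finset.mem_Icc] at hm1
    simp only [Finset.mem_Ioc] at hm2
    omega
  rw [← Finset.sum_union hdisj]
  refine Finset.sum_le_sum_of_subset_of_nonneg ?_ (fun m _ _ => ha m)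
  intro m hm
  simp only [Finset.mem_union, Finset.mem_Icc, Finset.mem_Ioc] at hm ⊢
  omega

/-- The analytic glue: at a common cut `η`, `small(η)` and `large(η)` give the crux's little-o statement
(stated here with the crux UNFOLDED, so that `MoebiusSwitchedHostLevel_of` below is the only declaration of
this file whose conclusion is the crux by name). [this line] -/
theorem littleO_of_split {η : ℝ}
    (hs : (fun x : ℕ => ∑ m ∈ Finset.Icc 1 ⌊(x : ℝ) ^ η⌋₊,
          |∑ e ∈ (chenSetB x).filter (fun e => m ∣ e), (ArithmeticFunction.moebius e : ℝ)|) =o[atTop]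
        fun x : ℕ => (x : ℝ) / Real.log x ^ 2)
    (hl : (fun x : ℕ => ∑ m ∈ Finset.Ioc ⌊(x : ℝ) ^ η⌋₊ ⌊(x : ℝ) ^ (0.499 : ℝ)⌋₊,
          |∑ e ∈ (chenSetB x).filter (fun e => m ∣ e), (ArithmeticFunction.moebius e : ℝ)|) =o[atTop]
        fun x : ℕ => (x : ℝ) / Real.log x ^ 2) :
    (fun x : ℕ => ∑ m ∈ Finset.Icc 1 ⌊(x : ℝ) ^ (0.499 : ℝ)⌋₊,
        |∑ e ∈ (chenSetB x).filter (fun e => m ∣ e), (ArithmeticFunction.moebius e : ℝ)|) =o[atTop]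
      fun x : ℕ => (x : ℝ) / Real.log x ^ 2 := by
  refine IsBigO.trans_isLittleO ?_ (hs.add hl)
  refine isBigO_of_le _ fun x => ?_
  set a : ℕ → ℝ := fun m => |∑ e ∈ (chenSetB x).filter (fun e => m ∣ e), (ArithmeticFunction.moebius e : ℝ)|
    with ha_def
  have ha : ∀ m, 0 ≤ a m := fun m => abs_nonneg _
  have h1 : 0 ≤ ∑ m ∈ Finset.Icc 1 ⌊(x : ℝ) ^ (0.499 : ℝ)⌋₊, a m := Finset.sum_nonneg fun m _ => ha m
  have h2 : 0 ≤ ∑ m ∈ Finset.Icc 1 ⌊(x : ℝ) ^ η⌋₊, a m + ∑ m ∈ Finset.Ioc ⌊(x : ℝ) ^ η⌋₊ ⌊(x : ℝ) ^ (0.499 : ℝ)⌋₊, a m :=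
    add_nonneg (Finset.sum_nonneg fun m _ => ha m) (Finset.sum_nonneg fun m _ => ha m)
  simp only [Real.norm_eq_abs]
  rw [abs_of_nonneg h1, abs_of_nonneg h2]
  exact split_le a ha _ _

/-- **THE SKELETON THEOREM** — the crux
`Summit.Parity.GeneralizedHardyLittlewood.Theses.ParityWeightedChenSwitching.MoebiusSwitchedHostLevel` BY NAME from
the two registered stubs: the level `η` of `stub_smallModuli` is fed to `stub_largeModuli` and the two ranges
are glued by `littleO_of_split`.  No `sorry` of its own; closed exactly when the two stubs are. [this line] -/
theorem MoebiusSwitchedHostLevel_of : MoebiusSwitchedHostLevel := by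
  obtain ⟨η, hη, -, hs⟩ := stub_smallModuli
  exact littleO_of_split hs (stub_largeModuli η hη)

/-- The hypothetical form `(stub₁-sig) → (stub₂-sig) → MoebiusSwitchedHostLevel` — pure logic in the stub
STATEMENTS, no stub used (an `example`, so that `MoebiusSwitchedHostLevel_of` stays the unique declaration of
this file concluding the crux). -/
example :
    (∃ η : ℝ, 0 < η ∧ η < 0.499 ∧
      (fun x : ℕ => ∑ m ∈ Finset.Icc 1 ⌊(x : ℝ) ^ η⌋₊,
          |∑ e ∈ (chenSetB x).filter (fun e => m ∣ e), (ArithmeticFunction.moebius e : ℝ)|) =o[atTop]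
        fun x : ℕ => (x : ℝ) / Real.log x ^ 2) →
    (∀ η : ℝ, 0 < η →
      (fun x : ℕ => ∑ m ∈ Finset.Ioc ⌊(x : ℝ) ^ η⌋₊ ⌊(x : ℝ) ^ (0.499 : ℝ)⌋₊,
          |∑ e ∈ (chenSetB x).filter (fun e => m ∣ e), (ArithmeticFunction.moebius e : ℝ)|) =o[atTop]
        fun x : ℕ => (x : ℝ) / Real.log x ^ 2) →
    MoebiusSwitchedHostLevel := by
  rintro ⟨η, hη, -, hs⟩ hL
  exact littleO_of_split hs (hL η hη)

-- audit: the conclusion is the route decl itself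
#check (MoebiusSwitchedHostLevel_of :
  Summit.Parity.GeneralizedHardyLittlewood.Theses.ParityWeightedChenSwitching.MoebiusSwitchedHostLevel)

end Summit.Parity.GeneralizedHardyLittlewood.Cruxes.MoebiusSwitchedHostLevel.Birth
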